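import Summits.Schanuel.Schanuel.Theorems.RootDecomp1KTrinomialDescent05

/-! PORT (census-1 g24, ×0 bookkeeping record port of lens-1 g65 FINDING F1 «W4 DOSSIER», RESULT/DONE L2987; kernel
 HOME/decomp-schanuel-lens-1/g65/lean/W4Dossier.lean sha256 8b7d393788582d7b…, 196 lines, 31 declarations, verbatim below this block but for ONE port-side modifier (`private` on `partialSum_two_zero`, dedup.landed twin of `RootDecomp1KRelLiouvilleCell.partialSum_two_zero`);
 crit g12 RULING L2988: F1 VERIFIED, ×0 BOOKKEEPING OF RECORD, port OPTIONAL at census discretion as a ×0 RECORD port; census STAGING NOTE 19 L2989; filed `--supports stmt-Schanuel-33364` (item OPEN, no closure, no credit). -/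

/-!
# RootDecomp1K — lens 1, generation 65: the STANDING WITNESS W4, typed dossier (×0 bookkeeping, no claim)

`W4P := (Y⁴ − 17)·x² + (Y³ + 1)·x + (Y + 2)` (tree `RootDecomp1KOddEmpty.W4P`) is the record's standing witness of the
NON-DOMINANT sector (K-R55/K-R56).  This file pins, BY TREE NAMES and hypothesis-free, where W4 sits:

* §1 shape: `xdeg W4P = 2`, `topX W4P = Q = Y⁴ − 17`, `natDegree W4P = 4`, `eTop W4P = 0`;
* §2 **W4 IS in node 11's CONDITIONAL class**: `SepTopAt m₀ W4P` for every `m₀ ≥ 1`, hence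
  `thinFibreAt_W4P_of_padicSubspace : PadicSubspace → ThinFibreAt m₀ W4P` (`m₀ ≥ 2`) — W4 is decided at every
  quality MODULO the record's binder `PadicSubspace` (Schlickewei's p-adic Subspace Theorem, a Literature named fact,
  NOT proved); so «W4 itself, hypothesis-free» is implied by (and is the record's cheapest reading of) a PROOF of that binder;
* §3 the hypothesis-free deciders of record REFUSE W4 by name: `¬ DecidedAt 2 W4P`, `¬ LocalAt m₀ W4P` (`m₀ ≤ 2`),
  `¬ GaussAt m₀ W4P`, `¬ XLinearLt`, `¬ XLinTM`, not two-term, not a cubic-descent curve `CB`, outside node 12's height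
  shape (`natDegree = 2·xdeg`); (`¬ OddEmptyAt`, `¬ TangentEmptyAt`, `¬ DomSuper`, `T j ≠ W4P`, `¬ FermatTri` are
  already in the tree);
* §4 W4 HAS a level point: `(s_0, 1) = (1/2, 1)` lies on W4 and is non-degenerate, so `0 ∈ LevelSet W4P 1` — no
  level-EMPTINESS engine (`no_level_…`) can ever present W4; only finiteness / thin-fibre currencies remain.

Rung 0: nothing here proves Schanuel, 33364, 33363, 31077, ThinFibre 2 or ThinFibreAt 2 W4P; §2 is CONDITIONAL on
`PadicSubspace` and says so in its signature.  No Literature import, no fact def, no sorry, no private, no set_option.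
-/

noncomputable section

namespace Summit.Schanuel.Schanuel.Theorems.RootDecomp1KW4Dossier

open Polynomial LiouvilleNumber
open scoped Nat
open Summit.Schanuel.Schanuel.Theorems.RootDecomp1KDegreeLadder
open Summit.Schanuel.Schanuel.Theorems.RootDecomp1KXLinear
open Summit.Schanuel.Schanuel.Theorems.RootDecomp1KXLinearII
open Summit.Schanuel.Schanuel.Theorems.RootDecomp1KXTop
open Summit.Schanuel.Schanuel.Theorems.RootDecomp1KXAll
open Summit.Schanuel.Schanuel.Theorems.RootDecomp1KLevelFinite
open Summit.Schanuel.Schanuel.Theorems.RootDecomp1KThueMahler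
open Summit.Schanuel.Schanuel.Theorems.RootDecomp1KLocalExponent
open Summit.Schanuel.Schanuel.Theorems.RootDecomp1KIntegrality (GaussAt gaussAt_xPolyP_iff)
open Summit.Schanuel.Schanuel.Theorems.RootDecomp1KSubspaceBranch (SepTopAt PadicSubspace thinFibreAt_of_sepTopAt)
open Summit.Schanuel.Schanuel.Theorems.RootDecomp1KHeightGrading (BddLevelEmpty bddLevelEmpty_iff_levelFinite)
open Summit.Schanuel.Schanuel.Theorems.RootDecomp1KCubicDescent
open Summit.Schanuel.Schanuel.Theorems.RootDecomp1KOddEmpty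

/-! ### §1 shape of W4 -/

/-- `w4C 2 = Q`. -/
theorem w4C_two : w4C 2 = vQ := by simp [w4C]
/-- `w4C 1 = G`. -/
theorem w4C_one : w4C 1 = vG := by simp [w4C]
/-- `w4C 0 = Y + 2`. -/
theorem w4C_zero : w4C 0 = X + C 2 := by simp [w4C]
/-- `(X + C 2 : ℤ[X]).natDegree = 1`. -/
theorem natDegree_w4C_zero : (w4C 0).natDegree = 1 := by rw [w4C_zero]; compute_degree!
/-- `w4C 2 ≠ 0`. -/
theorem w4C_two_ne_zero : w4C 2 ≠ 0 := by rw [w4C_two]; exact vQ_ne_zero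
/-- `xdeg W4P = 2`. -/
theorem xdeg_W4P : xdeg W4P = 2 := by rw [W4P]; exact xdeg_xPolyP 2 _ w4C_two_ne_zero
/-- `topX W4P = Q`. -/
theorem topX_W4P : topX W4P = vQ := by rw [W4P, topX_xPolyP 2 _ w4C_two_ne_zero, w4C_two]
/-- `4 ≤ natDegree W4P` (the `Y⁴x²` coefficient is `1`). -/
theorem four_le_natDegree_W4P : 4 ≤ W4P.natDegree := by
  refine le_natDegree_of_ne_zero fun h => ?_
  have h1 := congrArg (fun q : ℤ[X] => q.coeff 2) h
  simp only [W4P, coeff_coeff_xPolyP, coeff_zero] at h1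
  rw [if_pos (by simp), w4C_two, coeff_vQ_four] at h1
  exact one_ne_zero h1
/-- `natDegree W4P = 4`. -/
theorem natDegree_W4P : W4P.natDegree = 4 := by
  refine le_antisymm ?_ four_le_natDegree_W4P
  rw [W4P]
  refine natDegree_xPolyP_le 2 _ 4 fun i hi => ?_
  interval_cases i
  · rw [natDegree_w4C_zero]; norm_num
  · rw [w4C_one, natDegree_vG]; norm_num
  · rw [w4C_two, natDegree_vQ]
/-- `W4P ≠ 0`. -/
theorem W4P_ne_zero : W4P ≠ 0 := fun h => by
  have := four_le_natDegree_W4P; rw [h, natDegree_zero] at this; omega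
/-- `eTop W4P = 0` — FULL-DEGREE top. -/
theorem eTop_W4P : eTop W4P = 0 := by rw [eTop, natDegree_W4P, topX_W4P, natDegree_vQ]
/-- `¬ natDegree W4P < 2 * xdeg W4P` — OUTSIDE node 12's height shape (`4 = 2·2`, the boundary). -/
theorem not_natDegree_W4P_lt : ¬ W4P.natDegree < 2 * xdeg W4P := by
  rw [natDegree_W4P, xdeg_W4P]; norm_num

/-! ### §2 W4 is in node 11's CONDITIONAL class (separable top `Q`, `eTop = 0`) -/

/-- **`SepTopAt m₀ W4P` for every `m₀ ≥ 1`**: the top `Q = Y⁴ − 17` is separable over `ℚ` and `eTop W4P + 1 = 1 ≤ m₀`. -/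
theorem sepTopAt_W4P {m₀ : ℕ} (hm : 1 ≤ m₀) : SepTopAt m₀ W4P := by
  refine ⟨?_, ?_⟩
  · rw [topX_W4P]; exact separable_vQ_rat
  · rw [eTop_W4P]; exact hm
/-- **W4 is DECIDED at every quality `m₀ ≥ 2` MODULO `PadicSubspace`** (node 11's engine `thinFibreAt_of_sepTopAt`,
by name).  HONEST: `PadicSubspace` (Schlickewei's p-adic Subspace Theorem) is a binder of the route, NOT proved. -/
theorem thinFibreAt_W4P_of_padicSubspace (hS : PadicSubspace) {m₀ : ℕ} (hm : 2 ≤ m₀) : ThinFibreAt m₀ W4P :=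
  thinFibreAt_of_sepTopAt hS hm (sepTopAt_W4P (by omega))

/-! ### §3 the hypothesis-free deciders of record refuse W4, by name -/

/-- W4 has NO x-linear presentation (second difference of `P(x, 0) = −17x² + x + 2` in `x` is `−34 ≠ 0`). -/
theorem W4P_ne_xLinP (A B : ℤ[X]) : W4P ≠ xLinP A B := by
  intro hP
  have h := fun x : ℝ => congrArg (fun Q => bev Q x 0) hP
  have h0 := h 0
  have h1 := h 1
  have h2 := h 2
  simp only [bev_W4P, bev_xLinP] at h0 h1 h2
  have : (-34 : ℝ) = 0 := by linear_combination h0 - 2 * h1 + h2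
  norm_num at this
/-- `¬ XLinearLt W4P` (node 2). -/
theorem not_xLinearLt_W4P : ¬ XLinearLt W4P := fun ⟨A, B, _, _, hP⟩ => W4P_ne_xLinP A B hP
/-- `¬ XLinTM W4P` (node 16). -/
theorem not_xLinTM_W4P : ¬ XLinTM W4P := fun ⟨A, B, _, _, _, _, hP⟩ => W4P_ne_xLinP A B hP
/-- not a conjugate-poles norm shape of node 10. -/
theorem W4P_ne_normShapeCurve (g q : ℤ[X]) (n : ℕ) (D : ℤ) : W4P ≠ normShapeCurve g q n D := by
  rw [normShapeCurve_eq_xLinP]; exact W4P_ne_xLinP _ _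
/-- not a two-term curve `x^k·B(Y) − A(Y)` (nodes 5–9: the `x`-support of W4 is `{0, 1, 2}`). -/
theorem W4P_ne_twoTermP (k : ℕ) (B A : ℤ[X]) : W4P ≠ twoTermP k B A := by
  intro h
  have hc : ∀ i i' : ℕ, (if i' ∈ Finset.range 3 then (w4C i').coeff i else 0) =
      ((if i' = k then B.coeff i else 0) - (if i' = 0 then A.coeff i else 0)) := by
    intro i i'
    rw [← coeff_coeff_xPolyP, ← coeff_coeff_twoTermP, ← h]; rfl
  by_cases hk : k = 1
  · subst hk
    have h02 := hc 0 2
    rw [if_pos (by simp), if_neg (by norm_num), if_neg (by norm_num), w4C_two, coeff_vQ_zero] at h02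
    omega
  · have h01 := hc 0 1
    rw [if_pos (by simp), if_neg (fun h => hk h.symm), if_neg (by norm_num), w4C_one, coeff_vG_zero] at h01
    omega
/-- in EVERY presentation `W4P = Σ_{i ≤ k} x^i c_i(Y)` the top has a `ℚ₂`-root (it is `Q` or `0`). -/
theorem exists_padic_root_top_of_W4P_eq (k : ℕ) (c : ℕ → ℤ[X]) (h : W4P = xPolyP k c) :
    ∃ z : ℚ_[2], aeval z (c k) = 0 := by
  by_cases hck : c k = 0
  · exact ⟨0, by rw [hck, map_zero]⟩
  · have h1 := topX_W4P
    rw [h, topX_xPolyP k c hck] at h1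
    rw [h1]; exact exists_padic_root_vQ
/-- `¬ RootlessTop e W4P` (node 14's rootless-top class, any `e`). -/
theorem not_rootlessTop_W4P (e : ℕ) : ¬ RootlessTop e W4P := by
  rintro ⟨k, c, -, hroot, h⟩
  obtain ⟨z, hz⟩ := exists_padic_root_top_of_W4P_eq k c h
  exact hroot z hz
/-- **`¬ DecidedAt 2 W4P`** — each of the five disjuncts of the record's decided class refuted. -/
theorem not_decidedAt_two_W4P : ¬ DecidedAt 2 W4P := by
  rintro (h | h | h | h | h)
  · have := four_le_natDegree_W4P; omega
  · exact not_xLinearLt_W4P h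
  · exact absurd h.1 (by norm_num)
  · have := three_le_thinThreshold W4P; omega
  · exact not_rootlessTop_W4P 1 h
/-- **`¬ LocalAt m₀ W4P` for `m₀ ≤ 2`** (node 14: `rootCond_topX_of_localAt` + `not_rootCond_vQ`). -/
theorem not_localAt_W4P {m₀ : ℕ} (hm : m₀ ≤ 2) : ¬ LocalAt m₀ W4P := fun h => by
  have hR := rootCond_topX_of_localAt h
  rw [topX_W4P] at hR
  exact not_rootCond_vQ hm hR
/-- **`¬ GaussAt m₀ W4P`** at ANY `m₀` (node 15: dominance fails at `i = 1`: `deg c₁ = 3 > 1 = deg c₀`). -/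
theorem not_gaussAt_W4P (m₀ : ℕ) : ¬ GaussAt m₀ W4P := by
  intro h
  rw [W4P] at h
  have := ((gaussAt_xPolyP_iff 2 w4C w4C_two_ne_zero).mp h).1 1 le_rfl (by norm_num)
  rw [w4C_one, natDegree_w4C_zero, natDegree_vG] at this
  omega
/-- `xCoeff W4P i = w4C i`. -/
theorem xCoeff_W4P (i : ℕ) : xCoeff W4P i = w4C i := by
  rw [W4P, xCoeff_xPolyP]
  split_ifs with h
  · rfl
  · simp [w4C, show i ≠ 2 by omega, show i ≠ 1 by omega, show i ≠ 0 by omega]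
/-- W4 is NOT a cubic-descent curve of node 20 (`c₀(CB) = −H` has `[Y²] = −1`; `c₀(W4P) = Y + 2` has `[Y²] = 0`). -/
theorem W4P_ne_CB (h₁ h₀ l₁ l₀ : ℤ) : W4P ≠ CB h₁ h₀ l₁ l₀ := by
  intro h
  have h1 := congrArg (fun P => (xCoeff P 0).coeff 2) h
  simp only [xCoeff_W4P, w4C_zero, xCoeff_CB, cbC_zero, coeff_neg, cbH, coeff_add, coeff_X_pow,
    coeff_C_mul_X, coeff_C, coeff_X] at h1
  norm_num at h1

/-! ### §4 W4 has a level point: `(s_0, 1) = (1/2, 1)` -/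

/-- `s_0 = 1/2` (`private`: the same statement is landed as `RootDecomp1KRelLiouvilleCell.partialSum_two_zero`; port-side modifier, census-1 g24). -/
private theorem partialSum_two_zero : partialSum 2 0 = 1 / 2 := by
  simp [partialSum]
/-- **`P(s_0, 1) = 0`**: `(1/4)(1 − 17) + (1/2)(1 + 1) + (1 + 2) = 0`. -/
theorem bev_W4P_level_zero : bev W4P (partialSum 2 0) ((1 : ℚ) : ℝ) = 0 := by
  rw [partialSum_two_zero, bev_W4P]; push_cast; norm_num
/-- the point is non-degenerate: `P(0, 1) = 3 ≠ 0`. -/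
theorem bev_W4P_zero_one : bev W4P 0 ((1 : ℚ) : ℝ) ≠ 0 := by
  rw [bev_W4P]; push_cast; norm_num
/-- **`0 ∈ LevelSet W4P 1`** — W4's level set is NONEMPTY: no level-emptiness engine can present W4. -/
theorem zero_mem_levelSet_W4P : (0 : ℕ) ∈ LevelSet W4P 1 :=
  ⟨1, by push_cast; norm_num, bev_W4P_level_zero, 0, bev_W4P_zero_one⟩
/-- hence W4 is NOT level-empty: `¬ ∀ C N, N ∉ LevelSet W4P C`. -/
theorem not_levelEmpty_W4P : ¬ ∀ (C : ℝ) (N : ℕ), N ∉ LevelSet W4P C := fun h => h 1 0 zero_mem_levelSet_W4P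

end Summit.Schanuel.Schanuel.Theorems.RootDecomp1KW4Dossier
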